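import Summits.ResolutionOfSingularities.ResolutionOfSingularities.Theorems.FrobeniusClosingPatchingRelPerfectDepthMultiHostCJSTransportLoopRP
import HarnessLib

/-!
# Crux `PatchingRelPerfect` (stmt-ResolutionOfSingularities-16161), chain W5.2 — F7(β) (β-AX) T2b-X, module 3 (v7):
# the JOINT TRANSPORT along a CJS sequence (pieces loop, iso-tolerant induction, END components)

[OURS · L1 W5.2 · F7(β) (β-AX) T2b-X (res-L1-w52-plan-1 CORRECTION G11-15′ (2): hand res-D-pv-054 g7)] Fact-free; def-free; the
X-side LIFT is the hypothesis `hlift` of module 1⁗ (`…DepthMultiHostCJSTransportPieceRP`: = `CylState.lift_of_open_bd`΄s conclusion universally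
closed) and the step-stable predicate΄s `hP` is targets-v7 `ChainW52F7BetaRP.StepStable P` verbatim (RULING G12-1 / NOTE G12-2): the CJS fields
`hsub`/`hBsing`/`hperm` of each `IsBPermissibleSequenceB.blowup` step are read on the carrier through `e` (`…TransportPerm`) against the reduced
total host trace, which the transport now carries as the EQUALITY `e⁻¹X_k = ⋃ Supp tr`, together with the converse boundary link; NOT statements of the manuscript under review
(Hironaka 2017); AI-written, weaker than expert review.

* (module 2 `…TransportLoopRP`: `joint_centre_auxRP` — ONE CJS centre, its pieces blown up one after the other, the CJS blowing up following;
  iso-tolerance `e : (new carrier) ≅ (CJS stage)`.)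
* `cjs_transport` — induction over `IsBPermissibleSequenceB X B σ X′ B′` on the initial carrier (any initial boundary `B` covered by
  the boundary traces): the cylinder state is carried to `S′` on `X′ ≫ X` with `cyl′.Z ≅ Z′`, the host traces covering `e⁻¹X′` and lying
  over `X`, the boundary traces linked / snc / preirreducible / drawn on `e⁻¹B′` and covering it; an arbitrary step-stable predicate `P S cyl`
  is carried from `P S₀ cyl₀` (res-L1-w52-plan-1 NOTE G11-24: Phase C΄s pole structure rides on it).
* (module 4 `…TransportEndRP`: the END components, the transport of F-32bR, the typed target `ChainW52F7BetaRP.CJSTransport₂`.)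

## References
* V. Cossart, U. Jannsen, S. Saito, LNM 2270 (2020), Thm. 1.4, (6.2), Def. 4.1. [CossartJannsenSaito2020]
* J. Kollár, *Lectures on Resolution of Singularities* (2007), (3.111) Steps 1–3. [Kollar2007]
* E. Bierstone, D. Grigoriev, P. Milman, J. Włodarczyk (2011), §4 Step 2b. [BierstoneGrigorievMilmanWlodarczyk2011]
* The Stacks Project, Tags 080A, 080B. [StacksProject]
-/

-- `Summit.<Summit>.<Sub>.Theorems` with `Sub = Summit` (single-conjunct summit, D-0017)
set_option linter.dupNamespace false

noncomputable section

open CategoryTheory CategoryTheory.Limits AlgebraicGeometry TopologicalSpace IsLocalRing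
open Literature.AlgebraicGeometry.Resolution Scheme.IdealSheafData
open Literature.AlgebraicGeometry.Hironaka2017.MonomialPart

namespace Summit.ResolutionOfSingularities.ResolutionOfSingularities.Theorems

universe u

namespace MultiHostCJS

open DepthMultiHost WeightTwoB

/-! ## §3 The joint transport along a CJS sequence -/

section Transport

variable (hlift : ∀ ⦃X X' : Scheme.{u}⦄ [IsNoetherian X] [IsLocallyNoetherian X'] (S : MultiHostState X)
    (cyl : CylState S) [IsIntegral cyl.Z] [IsNoetherian cyl.Z] (C : cyl.Z.IdealSheafData), C ≠ ⊥ →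
    Scheme.IsRegular C.subscheme → C = vanishingIdeal C.support →
    ∀ (𝓑 : List cyl.Z.IdealSheafData), (∀ T ∈ S.𝓔, T ≠ cyl.j.ker → cyl.bd T ∈ 𝓑) → HasSNCWith 𝓑 C →
    ∀ (τ : X' ⟶ X) (hτ : IsBlowup τ (vanishingIdeal (cyl.centre C))) (η : X), IsGenericPoint η (cyl.centre C : Set X) →
    ∀ (m : Fin S.n → ℕ), (∀ i, cyl.tr i ≤ C ^ m i) → ∀ (ν : ℕ), (∀ i, ν ≤ m i + weightAt (S.exps i) η) →
    ∃ (hsncX : HasSNCWith S.𝓔 (vanishingIdeal (cyl.centre C)))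
      (cyl' : CylState (S.step τ (cyl.centre C) η m ν hsncX hτ)) (τZ : cyl'.Z ⟶ cyl.Z),
      IsBlowup τZ C ∧ cyl'.j ≫ τ = τZ ≫ cyl.j ∧
      cyl'.j.ker = strictTransformIdeal τ (vanishingIdeal (cyl.centre C)) cyl.j.ker ∧
      (∀ i, cyl'.tr i = controlledTransform τZ C (cyl.tr i) (m i)) ∧
      (∀ T ∈ S.𝓔, T ≠ cyl.j.ker →
        cyl'.bd (strictTransformIdeal τ (vanishingIdeal (cyl.centre C)) T) = strictTransformIdeal τZ C (cyl.bd T)) ∧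
      cyl'.bd ((vanishingIdeal (cyl.centre C)).comap τ) = C.comap τZ ∧
      ((cyl'.V : Set X') ⊆ τ ⁻¹' (cyl.V : Set X)) ∧
      (τ ⁻¹' (cyl.V : Set X) \ (cyl'.V : Set X') ⊆
        ((controlledTransform τ (vanishingIdeal (cyl.centre C)) ((C.comap cyl.q).map cyl.V.ι) 1).support : Set X')) ∧
      (∀ T', cyl'.bd T' = T'.comap cyl'.j))


variable (P : ∀ ⦃X : Scheme.{u}⦄ (S : MultiHostState X), CylState S → Prop)
  (hP : ∀ ⦃X X' : Scheme.{u}⦄ [IsLocallyNoetherian X] [IsLocallyNoetherian X'] (S : MultiHostState X)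
    (cyl : CylState S) [IsIntegral cyl.Z] [IsNoetherian cyl.Z] (C : cyl.Z.IdealSheafData), C ≠ ⊥ →
    Scheme.IsRegular C.subscheme → C = vanishingIdeal C.support →
    ∀ (𝓑 : List cyl.Z.IdealSheafData), (∀ T ∈ S.𝓔, T ≠ cyl.j.ker → cyl.bd T ∈ 𝓑) → HasSNCWith 𝓑 C →
    ∀ (D : Closeds cyl.Z), (D : Set cyl.Z) = ⋃ i, ((cyl.tr i).support : Set cyl.Z) →
    vanishingIdeal D ≤ C →
    (∀ x ∈ (C.support : Set cyl.Z),
      ¬ IsRegularLocalRing ((cyl.Z.presheaf.stalk x) ⧸ stalkIdeal (vanishingIdeal D) x) ∨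
        ∃ T ∈ S.𝓔, T ≠ cyl.j.ker ∧ x ∈ ((cyl.bd T).support : Set cyl.Z)) →
    (∀ x ∈ (C.support : Set cyl.Z),
      ((stalkIdeal C x).map (Ideal.Quotient.mk (stalkIdeal (vanishingIdeal D) x))).IsPermissible) →
    ∀ (τ : X' ⟶ X) (hτ : IsBlowup τ (vanishingIdeal (cyl.centre C))) (η : X), IsGenericPoint η (cyl.centre C : Set X) →
    ∀ (m : Fin S.n → ℕ), (∀ i, cyl.tr i ≤ C ^ m i) → (∀ i, ¬ cyl.tr i ≤ C ^ (m i + 1)) →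
    ∀ (hsncX : HasSNCWith S.𝓔 (vanishingIdeal (cyl.centre C)))
      (cyl' : CylState (S.step τ (cyl.centre C) η m 0 hsncX hτ)) (τZ : cyl'.Z ⟶ cyl.Z),
      IsBlowup τZ C → cyl'.j ≫ τ = τZ ≫ cyl.j →
      cyl'.j.ker = strictTransformIdeal τ (vanishingIdeal (cyl.centre C)) cyl.j.ker →
      (∀ i, cyl'.tr i = controlledTransform τZ C (cyl.tr i) (m i)) →
      (∀ T ∈ S.𝓔, T ≠ cyl.j.ker →
        cyl'.bd (strictTransformIdeal τ (vanishingIdeal (cyl.centre C)) T) = strictTransformIdeal τZ C (cyl.bd T)) →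
      cyl'.bd ((vanishingIdeal (cyl.centre C)).comap τ) = C.comap τZ → ((cyl'.V : Set X') ⊆ τ ⁻¹' (cyl.V : Set X)) →
      (τ ⁻¹' (cyl.V : Set X) \ (cyl'.V : Set X') ⊆
        ((controlledTransform τ (vanishingIdeal (cyl.centre C)) ((C.comap cyl.q).map cyl.V.ι) 1).support : Set X')) →
      P S cyl → P (S.step τ (cyl.centre C) η m 0 hsncX hτ) cyl')

include hlift hP

/-- [OURS · L1 W5.2 · F7(β) T2b-X] **THE JOINT TRANSPORT along a CJS sequence** (ISO-TOLERANT induction over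
`IsBPermissibleSequenceB X B σ X′ B′` on the initial carrier; pattern of R5ᴴ N3 `HSepCJS.cjs_transport`).  Initial data: `X₀`
Noetherian regular, a cylinder state `cyl₀` over `S₀` with integral Noetherian regular carrier, boundary traces `𝓑₀` linked to the
members, snc, preirreducible, drawn on `B` and covering it, and a closed `X ⊆ ⋃ Supp tr⁰ᵢ`.  Output at every stage: `X₁ → X₀` ONE
blowing up supported on the initial carrier, `X₁` regular, `K₁ = π^*K₀`, same number of summands, a cylinder state whose carrier is
`≅ Z′` over `Z₀` (`e.hom ≫ σ = ρ`, `j₁ ≫ π = ρ ≫ j₀`), the host traces covering `e⁻¹X′` and lying over `⋃ Supp tr⁰`, the boundary traces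
linked / snc / preirreducible / drawn on `e⁻¹B′` and covering it.  CJS steps with EMPTY centre are absorbed into `e`; the others are
re-sequenced piece by piece on the carrier (`centre_pieces`, `joint_centre_auxRP`).
[cite: CossartJannsenSaito2020, Thm. 1.4, (6.2), Def. 4.1] [cite: Kollar2007, (3.111) Steps 1–3] [cite: StacksProject, Tag 080B] -/
theorem cjs_transport {X₀ : Scheme.{u}} [IsNoetherian X₀] (hX₀ : Scheme.IsRegular X₀) (S₀ : MultiHostState X₀)
    (cyl₀ : CylState S₀) [IsIntegral cyl₀.Z] [IsNoetherian cyl₀.Z] (hZ₀ : Scheme.IsRegular cyl₀.Z) (h₀ : P S₀ cyl₀)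
    (𝓑₀ : List cyl₀.Z.IdealSheafData) (hlink₀ : ∀ T ∈ S₀.𝓔, T ≠ cyl₀.j.ker → cyl₀.bd T ∈ 𝓑₀) (hsnc₀ : HasSNC 𝓑₀)
    (hirr₀ : ∀ T ∈ 𝓑₀, IsPreirreducible (T.support : Set cyl₀.Z))
    {Xs B : Set cyl₀.Z} (hXc : IsClosed Xs) (hXs : Xs = ⋃ i, ((cyl₀.tr i).support : Set cyl₀.Z))
    (hB : ∀ T ∈ 𝓑₀, (T.support : Set cyl₀.Z) ⊆ B) (hcovB : ∀ z ∈ B, ∃ T ∈ 𝓑₀, z ∈ T.support)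
    (hINV₀ : ∀ T' ∈ 𝓑₀, ∃ T ∈ S₀.𝓔, T ≠ cyl₀.j.ker ∧ cyl₀.bd T = T') :
    ∀ {Z' : Scheme.{u}} {σ : Z' ⟶ cyl₀.Z} {X' B' : Set Z'}, IsBPermissibleSequenceB Xs B σ X' B' →
      IsClosed X' ∧ ∃ (X₁ : Scheme.{u}) (π : X₁ ⟶ X₀) (_ : IsNoetherian X₁) (S₁ : MultiHostState X₁) (cyl₁ : CylState S₁)
        (ρ : cyl₁.Z ⟶ cyl₀.Z) (_ : IsIntegral cyl₁.Z) (_ : IsNoetherian cyl₁.Z) (_ : IsNoetherian Z') (e : cyl₁.Z ≅ Z')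
        (𝓑₁ : List cyl₁.Z.IdealSheafData),
        P S₁ cyl₁ ∧ (∃ Q : X₀.IdealSheafData, IsBlowup π Q ∧ (Q.support : Set X₀) ⊆ Set.range cyl₀.j) ∧
        Scheme.IsRegular X₁ ∧ S₁.K = S₀.K.comap π ∧ S₁.n = S₀.n ∧ cyl₁.j ≫ π = ρ ≫ cyl₀.j ∧ e.hom ≫ σ = ρ ∧
        Scheme.IsRegular cyl₁.Z ∧
        (∀ T ∈ S₁.𝓔, T ≠ cyl₁.j.ker → cyl₁.bd T ∈ 𝓑₁) ∧ HasSNC 𝓑₁ ∧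
        (∀ T' ∈ 𝓑₁, IsPreirreducible (T'.support : Set cyl₁.Z)) ∧
        e.hom ⁻¹' X' = ⋃ i, ((cyl₁.tr i).support : Set cyl₁.Z) ∧
        (∀ i', ((cyl₁.tr i').support : Set cyl₁.Z) ⊆ ρ ⁻¹' ⋃ i, ((cyl₀.tr i).support : Set cyl₀.Z)) ∧
        (∀ T' ∈ 𝓑₁, (T'.support : Set cyl₁.Z) ⊆ e.hom ⁻¹' B') ∧
        (∀ z : cyl₁.Z, e.hom z ∈ B' → ∃ T' ∈ 𝓑₁, z ∈ T'.support) ∧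
        (∀ T' ∈ 𝓑₁, ∃ T ∈ S₁.𝓔, T ≠ cyl₁.j.ker ∧ cyl₁.bd T = T') := by
  intro Z' σ X' B' h
  induction h with
  | refl =>
    refine ⟨hXc, X₀, 𝟙 X₀, inferInstance, S₀, cyl₀, 𝟙 cyl₀.Z, inferInstance, inferInstance, inferInstance, Iso.refl _, 𝓑₀, h₀,
      ⟨⊤, isBlowup_id_top X₀, by rw [Scheme.IdealSheafData.support_top]; exact fun x hx => absurd hx id⟩, hX₀,
      by rw [Scheme.IdealSheafData.comap_id], rfl, by rw [Category.comp_id, Category.id_comp],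
      by rw [Iso.refl_hom, Category.id_comp], hZ₀, hlink₀, hsnc₀, hirr₀, ?_, fun i' x hx => ?_,
      fun T hT x hx => by simpa using hB T hT hx, fun z hz => hcovB z (by simpa using hz), hINV₀⟩
    · rw [Iso.refl_hom, preimage_id']
      exact hXs
    · exact Set.mem_iUnion.mpr ⟨i', hx⟩
  | @blowup Z' Z'' σ X' B' _ C τ hτ hreg hsub hBsing hperm hnc ih =>
    obtain ⟨hX'c, X₁, π₁, hnoethX₁, S₁, cyl₁, ρ₁, hint₁, hnoeth₁, hnoethZ', e, 𝓑₁, hP₁, ⟨Q₁, hQ₁, hQ₁s⟩, hX₁, hK₁, hn₁, hj₁,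
      he₁, hZ₁, hlink₁, hsnc₁, hirr₁, hlow₁, hup₁, hbd₁, hcov₁, hINV₁⟩ := ih
    haveI := hnoethX₁
    haveI := hint₁
    haveI := hnoeth₁
    haveI := hnoethZ'
    haveI : IsNoetherian Z'' := isNoetherian_of_isBlowup hτ
    refine ⟨isClosed_closure, ?_⟩
    by_cases hC0 : C = ⊤
    · /- EMPTY centre: `τ` is an isomorphism, absorbed into `e` -/
      haveI := isIso_of_isBlowup_top hτ hC0
      have hCs : (C.support : Set Z') = ∅ := by
        rw [hC0, Scheme.IdealSheafData.support_top]; rfl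
      refine ⟨X₁, π₁, hnoethX₁, S₁, cyl₁, ρ₁, hint₁, hnoeth₁, inferInstance, e ≪≫ (asIso τ).symm, 𝓑₁, hP₁, ⟨Q₁, hQ₁, hQ₁s⟩,
        hX₁, hK₁, hn₁, hj₁, ?_, hZ₁, hlink₁, hsnc₁, hirr₁, ?_, hup₁, fun T' hT' => ?_, fun z hz => ?_, hINV₁⟩
      · rw [Iso.trans_hom, Iso.symm_hom, asIso_inv, Category.assoc, IsIso.inv_hom_id_assoc, he₁]
      · rw [hCs, Set.sdiff_empty, (hX'c.preimage τ.continuous).closure_eq, Iso.trans_hom, Iso.symm_hom, asIso_inv,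
          preimage_comp', preimage_inv_preimage]
        exact hlow₁
      · rw [hCs, Set.union_empty, Iso.trans_hom, Iso.symm_hom, asIso_inv, preimage_comp', preimage_inv_preimage]
        exact hbd₁ T' hT'
      · refine hcov₁ z ?_
        have hz' : z ∈ ⇑(e ≪≫ (asIso τ).symm).hom ⁻¹' (⇑τ ⁻¹' (B' ∪ (C.support : Set Z'))) := hz
        rw [hCs, Set.union_empty, Iso.trans_hom, Iso.symm_hom, asIso_inv, preimage_comp', preimage_inv_preimage] at hz'
        exact hz'
    · /- NON-EMPTY centre: re-sequence along the pieces of `e^* C` on the carrier -/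
      obtain ⟨hC₀reg, -, hPart, hC₀s, hΓ⟩ := centre_pieces e hsnc₁ hX'c hlow₁.le hbd₁ hC0 hreg hsub hnc
      have hτE : IsBlowup (τ ≫ e.inv) (C.comap e.hom) := by
        have h := hτ.comp_iso e.symm
        rwa [Iso.symm_hom, Iso.symm_inv] at h
      -- the CJS data of the centre, read on the carrier through `e`
      let D : Closeds cyl₁.Z :=
        ⟨⋃ i, ((cyl₁.tr i).support : Set cyl₁.Z), isClosed_iUnion_of_finite fun i => (cyl₁.tr i).support.isClosed⟩
      have hD : (D : Set cyl₁.Z) = ⋃ i, ((cyl₁.tr i).support : Set cyl₁.Z) := rfl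
      have hXcl : (⟨closure X', isClosed_closure⟩ : Closeds Z') = ⟨X', hX'c⟩ := Closeds.ext hX'c.closure_eq
      have hDe : (⟨X', hX'c⟩ : Closeds Z').preimage e.hom.continuous = D := Closeds.ext (by
        rw [Closeds.coe_preimage, hD, ← hlow₁]; rfl)
      have hDstalk : ∀ y : cyl₁.Z, stalkIdeal (vanishingIdeal D) y =
          stalkIdeal ((vanishingIdeal ⟨closure X', isClosed_closure⟩).comap e.hom) y := fun y => by
        rw [hXcl, comap_vanishingIdeal_of_isOpenImmersion, hDe]
      have hmemC : ∀ y : cyl₁.Z, y ∈ ((C.comap e.hom).support : Set cyl₁.Z) → e.hom y ∈ (C.support : Set Z') := fun y hy => by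
        rw [hC₀s] at hy; exact hy
      have hpm : ∀ y ∈ ((C.comap e.hom).support : Set cyl₁.Z),
          ((stalkIdeal (C.comap e.hom) y).map (Ideal.Quotient.mk (stalkIdeal (vanishingIdeal D) y))).IsPermissible := by
        intro y hy
        rw [hDstalk]
        exact isPermissible_stalk_comap e.hom y C _ (hperm _ (hmemC y hy))
      have hBs : ∀ y ∈ ((C.comap e.hom).support : Set cyl₁.Z),
          ¬ IsRegularLocalRing ((cyl₁.Z.presheaf.stalk y) ⧸ stalkIdeal (vanishingIdeal D) y) ∨
            ∃ T ∈ S₁.𝓔, T ≠ cyl₁.j.ker ∧ y ∈ ((cyl₁.bd T).support : Set cyl₁.Z) := by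
        intro y hy
        rcases hBsing _ (hmemC y hy) with h | h
        · left
          rw [hDstalk]
          exact not_isRegularLocalRing_stalk_comap e.hom y _ h
        · right
          obtain ⟨T', hT', hyT'⟩ := hcov₁ y h
          obtain ⟨T, hT, hne, hbdT⟩ := hINV₁ T' hT'
          exact ⟨T, hT, hne, hbdT ▸ hyT'⟩
      obtain ⟨X₂, π₂, hnoethX₂, S₂, cyl₂, ρ₂, hint₂, hnoeth₂, e₂, 𝓑₂, hP₂, ⟨Q₂, hQ₂, hQ₂s⟩, hX₂, hK₂, hn₂, hj₂, he₂, hZ₂,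
        hlink₂, hsnc₂, hirr₂, hlow₂, hup₂, hbd₂, hcov₂, hDeq₂, hINV₂⟩ :=
        joint_centre_auxRP hlift P hP _ hX₁ S₁ cyl₁ hZ₁ hP₁ 𝓑₁ hlink₁ hsnc₁ hirr₁ hC₀reg rfl hPart hΓ
          (B₀ := e.hom ⁻¹' (B' ∪ (C.support : Set Z')))
          (fun T hT => (hbd₁ T hT).trans (Set.preimage_mono Set.subset_union_left))
          (by rw [hC₀s]; exact Set.preimage_mono Set.subset_union_right)
          (fun x hx => by
            rcases hx with hx | hx
            · exact Or.inl (hcov₁ x hx)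
            · right; rwa [hC₀s])
          hINV₁ D hD hBs hpm hτE
      haveI := hnoethX₂
      haveI := hint₂
      haveI := hnoeth₂
      -- `e₂.hom ≫ τ = ρ₂ ≫ e.hom`
      have heτ : e₂.hom ≫ τ = ρ₂ ≫ e.hom := by
        have h := congrArg (· ≫ e.hom) he₂
        simpa only [Category.assoc, e.inv_hom_id, Category.comp_id] using h
      have heτx : ∀ x : cyl₂.Z, τ (e₂.hom x) = e.hom (ρ₂ x) := fun x => by
        rw [← Scheme.Hom.comp_apply, heτ, Scheme.Hom.comp_apply]
      refine ⟨X₂, π₂ ≫ π₁, hnoethX₂, S₂, cyl₂, ρ₂ ≫ ρ₁, hint₂, hnoeth₂, inferInstance, e₂, 𝓑₂, hP₂, ?_, hX₂, ?_,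
        hn₂.trans hn₁, ?_, ?_, hZ₂, hlink₂, hsnc₂, hirr₂, ?_, fun i' x hx => ?_, fun T' hT' x hx => ?_, fun z hz => hcov₂ z ?_,
        hINV₂⟩
      · -- the tower (Stacks 080B)
        obtain ⟨Q, hQ, hQs⟩ := IsBlowup.exists_isBlowup_comp_supported π₁ Q₁ π₂ Q₂ (Set.range cyl₀.j) hQ₁ hQ₁s hQ₂
          (hQ₂s.trans (by
            rintro x ⟨z, rfl⟩
            change π₁ (cyl₁.j z) ∈ Set.range cyl₀.j
            rw [← Scheme.Hom.comp_apply, hj₁, Scheme.Hom.comp_apply]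
            exact ⟨ρ₁ z, rfl⟩))
        exact ⟨Q, hQ, hQs⟩
      · rw [hK₂, hK₁, ← Scheme.IdealSheafData.comap_comp]
      · rw [← Category.assoc, hj₂, Category.assoc, hj₁, Category.assoc]
      · rw [← Category.assoc, heτ, Category.assoc, he₁]
      · -- `e₂⁻¹ cl τ⁻¹(X′ ∖ V(C)) = ⋃ Supp tr″` (the strict transform of the total host trace, piece by piece)
        have h1 : e₂.hom ⁻¹' closure (τ ⁻¹' (X' \ (C.support : Set Z'))) = closure (e₂.hom ⁻¹' (τ ⁻¹' (X' \ (C.support : Set Z')))) :=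
          (Scheme.homeoOfIso e₂).preimage_closure _
        have h2 : e₂.hom ⁻¹' (τ ⁻¹' (X' \ (C.support : Set Z'))) = ρ₂ ⁻¹' ((D : Set cyl₁.Z) \ ((C.comap e.hom).support : Set cyl₁.Z)) := by
          ext x
          rw [Set.mem_preimage, Set.mem_preimage, heτx, Set.mem_preimage, hD, ← hlow₁, hC₀s]
          rfl
        rw [h1, h2, hDeq₂]
      · -- upper bound through the two stages
        obtain ⟨i₁, hi₁⟩ := Set.mem_iUnion.mp (hup₂ i' hx)
        have h := hup₁ i₁ hi₁
        simpa only [Set.mem_preimage, Scheme.Hom.comp_base, TopCat.coe_comp, Function.comp_apply] using h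
      · have h1 := hbd₂ T' hT' hx
        rw [Set.mem_preimage, Set.mem_preimage, heτx]
        exact h1
      · rw [Set.mem_preimage, heτx] at hz
        exact hz

end Transport

end MultiHostCJS

end Summit.ResolutionOfSingularities.ResolutionOfSingularities.Theorems

end
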